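import Summits.HodgeConjecture.HodgeCM.Model.AdelicThetaDistributionOfGPins
import Literature.NumberTheory.GelbartRogawski1991.CompatibleSplittingCM
import HarnessLib

/-!
# FLOOR-0 P4, seat S4′(i) — the model's theta-distribution datum AT A LINE `⟨a⟩` through the DEGENERATE SEESAW CONTEXT `cDiag a`
# (DECISIONS-T3a v1 D2 ∕ D4: `cDiag`, `S_a`, `D₀` with their `rfl` read-backs — ONE instantiation file for P2 and P4)

Cell hodgecm-mathlib (D-0151), FLOOR 0, crux item H413 = stmt-HodgeConjecture-24833; programme P4, line
`Cruxes/H413/Lines/F0_P4AdmissibleOccursInH1.lean` (ed. 1.3), stub S4′ `stub_T3a_holThetaRealisationOfRallisAt`.  Author F0P4-p01 (g0)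
(seat (i)).  `--supports stmt-HodgeConjecture-24833 --as helper`.  KERNEL ONLY: definitions re-instantiating the HodgeCM MODEL layer at a
single line, and `rfl`∕bookkeeping theorems; nothing is cited as a fact, no `sorry`.

WHY.  The model (`HodgeCM/Model/*`) constructs theta distributions `ThetaDistDatum.dist` into weight-`τ₁` hol-germ forms, with their laws
`dist_ωf_V` ∕ `dist_ωf_W` ∕ `dist_mem_weightForms` ∕ `isHolGerm_dist`, over a SEESAW CONTEXT `c : SeesawCtx L` (four hermitian lines
`W₀,…,W₃` with `W₀ ⊕ W₁ ≅ W₂ ⊕ W₃`, PerL Def. 3.2) and its SIDE `S : ThetaAdelicSide V c`.  S4′ needs the same objects at ONE line — the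
ADMISSIBLE line `⟨a_e⟩` of a triple (★ `Theorems/H413AdmissibleLineSign.exists_admissibleLine`, F0P4-plan 21:47:47Z (1)).  DECISIONS D2:
the seesaw structure carries NO constraint beyond the isometry, so the DIAGONAL context `cDiag a := (a, a, a, a; g = 1)` is a seesaw context
for every real non-zero `a`, and every slot theorem of the model transfers verbatim to it.  This file is that instantiation (CHECK-FIRST of D2,
answered: the term elaborates; the only inputs left are the honest ones listed below):

* §1 `seesawDiag a`, **`cDiag Φ σ a`** (`K := L`, all four CM types `:= Φ`, eigen-embedding `σ`), read-backs `cDiag_D_a`, `dW_cDiag`,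
  `dW'_cDiag`; the compatible-splitting facts the side asks for are FREE at every line (★ `GRConstruction.compatibleSplitting_cmSplittingDatum`):
  `compat_plane`, `compat_line₀ … compat_line₃`; the sign clause `h₁W` is free too (`h₁W_cDiag`: `re ι₁(a) ≠ 0` for real `a ≠ 0`).
* §2 **`sideAt`** `:= ★ archSideOfT V (cDiag Φ σ a) …` — the model's (R1) ν-carrying side at the diagonal context: INPUTS = a pair character
  `η : U(V)(𝔸) × U(W₀⊕W₁)(𝔸) →* ℂˣ` trivial on rational points and continuous (`hη`, `hηc`), a `U(V)(𝔸)`-character `ν` likewise (`hν`, `hνc`)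
  — the two knobs by which junction J aligns the model's CHOSEN compatible splitting `splittingOf hGR₀` with the pin's `μ`-splitting
  (★ `IsCompatible.exists_central_twist`, ★ `adelicMpCont.exists_eq_twist_continuous`) — and the archimedean test data `A k : ArchLineInput`;
  the Weil hypotheses (W-maj⁺)∕(W-rat⁺) are discharged inside ★ `archSideOfT`.  Read-backs `sideAt_P_ω` (`= lineRepOf … (etaT₀ η ν) …`), `sideAt_ιinf`.
* §3 **`distDatumAt`** `:= ★ thetaDistDatumZeroOfT …` — the honest (J4) product datum of slot `0` at the diagonal context: INPUTS = the
  harmonic archimedean family `Φarch` with its law `harm` (★ `harm_lineOmega_zeroG` supplies it from `hemb`, the `hpos` of ★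
  `Theorems/H413AdmissibleLineOrient.cmXW_cmPlace_admissibleLine_pos_of_mem`, and the `K`-type row `hχ`) and the definite-place clause `hdef`
  (★ `harch_zero_of_defType_tmulG`).  Read-backs: `distDatumAt_ωf` (`= finRepZero V (cDiag …).D compat_plane compat_line₀ compat_line₁ (etaT₀ …)`
  — THE TARGET OF JUNCTION J against the pin's `finPairRepW … (JW a) … (hs a)`), `distDatumAt_Uf`, `distDatumAt_toIdele`, `distDatumAt_ωA`.

What is NOT here (honest census for the desk): junction J itself (`finRepZero` at `cDiag a` vs the pin's `finPairRepW` at `JW a = !![a]`: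
Gram spellings `Matrix.diagonal (lineVec a)` ∕ `realDiagonal` vs `JW a` ∕ `TW a` differ as TERMS, the model uses its twin `HodgeCM.WeilCoinv.finPairRep`
at `splittingOf hGR₀ = hGR₀.choose`, and the reindex `finSBReindex e₁` + the scalar `finCharZero = etaT₀ η ν · cmLineChar₀` intervene), the line
transport (LT) `ω(a_t) ≃ ω(a_e)` (A-p17 (g12)), the archimedean inputs `Φarch`∕`harm`∕`hχ`∕`hdef` at a general weight-one `μ`, and non-vanishing (seat (ii)).
HC_CM is proved only modulo the printed citations until rung 0 closes.

## References
* Tree (model layer, all ★): `HodgeCM/StubTree/PerLProof` (`SeesawDatum`), `HodgeCM/Automorphic/ThetaModel` (`SeesawCtx`),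
  `HodgeCM/Model/ArchSideOfTwist` (`archSideOfT`, `lineRepT`, `etaT₀`), `HodgeCM/Model/AdelicThetaDistributionOfG(Pins)` (`thetaDistDatumZeroOfT`,
  `ThetaDistDatum`), `HodgeCM/Model/AdelicThetaDistributionFin_1` (`UfZero`, `finRepZero`), `Literature/NumberTheory/GelbartRogawski1991/CompatibleSplittingCM`
  (`compatibleSplitting_cmSplittingDatum`).
* [Liu2021] Y. Liu, Camb. J. Math. 9 (2021) = arXiv:2102.11518, proof of Prop. 4.13 (l. 2145), Def. 4.11–4.12, App. D Lem. D.2.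
* [GelbartRogawski1991] S. Gelbart, J. Rogawski, Invent. Math. 105 (1991), §3.1 Prop. 3.1.1, Remark p. 457.  [Weil1964] A. Weil, Acta Math. 111 (1964), n° 41.
-/

set_option autoImplicit false
set_option linter.dupNamespace false

noncomputable section

open NumberField NumberField.InfinitePlace NumberField.mixedEmbedding IsDedekindDomain MulAction
open scoped Matrix TensorProduct Classical SchwartzMap
open Literature.NumberTheory.Automorphic Literature.NumberTheory.Weil1964
open Literature.NumberTheory.GelbartRogawski1991 Literature.NumberTheory.GelbartRogawski1991.UnitaryDualPair
open Literature.NumberTheory.GelbartRogawski1991.GRConstruction (compatibleSplitting_cmSplittingDatum)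
open Literature.Geometry.ComplexHyperbolic.BallModel (U21 x₀)
open Literature.AlgebraicGeometry.ShimuraVarieties
open Literature.AlgebraicGeometry.Motives (CMType)
open HodgeCM HodgeCM.Adelic HodgeCM.PerL34 HodgeCM.Model HodgeCM.Model.ArchSideTerm HodgeCM.Model.ThetaDistFin HodgeCM.Model.ThetaAdelicSide

namespace Summit.HodgeConjecture.HodgeConjecture.Cruxes.H413.ThetaDistAtLine

variable {L : CMField} {ι₁ : L →+* ℂ} (V : HermSpace3 L ι₁)

/-! ## §1 The degenerate seesaw context `cDiag a` and its free hypotheses -/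

/-- **the degenerate seesaw datum at the line `a`**: all four hermitian lines equal to `⟨a⟩`, the isometry `W₀ ⊕ W₁ ≅ W₂ ⊕ W₃` being the
identity (`g = 1`).  (PerL Def. 3.2's structure carries no other constraint.) -/
def seesawDiag (a : (L : Type)) (ha : IsCMField.complexConj (L : Type) a = a) (ha0 : a ≠ 0) : StubTree.SeesawDatum L where
  a := fun _ => a
  a_real := fun _ => ha
  a_ne := fun _ => ha0
  iso := ⟨1, by
    rw [Units.val_one, Matrix.transpose_one, Matrix.map_one _ (map_zero _) (map_one _), one_mul, mul_one]⟩

/-- **the degenerate seesaw CONTEXT at the line `a`** (`K := L`, the four CM types all `:= Φ`, eigen-embedding `:= σ`, datum `:= seesawDiag a`). -/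
def cDiag (Φ : CMType (L : Type)) (σ : (L : Type) →+* ℂ) (a : (L : Type)) (ha : IsCMField.complexConj (L : Type) a = a) (ha0 : a ≠ 0) :
    SeesawCtx L :=
  ⟨L, fun _ => Φ, σ, seesawDiag a ha ha0⟩

section ReadBack

variable (Φ : CMType (L : Type)) (σ : (L : Type) →+* ℂ) (a : (L : Type)) (ha : IsCMField.complexConj (L : Type) a = a) (ha0 : a ≠ 0)

/-- every line of `cDiag a` is `a`. -/
@[simp] theorem cDiag_D_a (i : Fin 4) : (cDiag Φ σ a ha ha0).D.a i = a := rfl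

/-- the plane frame of `cDiag a` is `(a, a)`. -/
@[simp] theorem dW_cDiag (j : Fin 2) : dW (cDiag Φ σ a ha ha0).D j = a := by
  fin_cases j <;> rfl

/-- the conjugate plane frame of `cDiag a` is `(a, a)`. -/
@[simp] theorem dW'_cDiag (j : Fin 2) : dW' (cDiag Φ σ a ha ha0).D j = a := by
  fin_cases j <;> rfl

/-- slot `0` of `cDiag a` is the line `a`, definitionally. -/
theorem dW_cDiag_zero : dW (cDiag Φ σ a ha ha0).D 0 = a := rfl

/-- **`hGR` is free**: the compatible splitting of the PLANE pair `(V, ⟨a⟩ ⊕ ⟨a⟩)` exists ([GR91] Prop. 3.1.1, CM case, ★ `compatibleSplitting_cmSplittingDatum`). -/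
theorem compat_plane :
    (cmSplittingDatum (L : Type) finProdFinEquiv (frameD V) (frameD_real V) (frameD_ne V) (dW (cDiag Φ σ a ha ha0).D)
      (dW_real (cDiag Φ σ a ha ha0).D) (dW_ne (cDiag Φ σ a ha ha0).D)).CompatibleSplitting :=
  compatibleSplitting_cmSplittingDatum (L : Type) finProdFinEquiv (frameD V) (frameD_real V) (frameD_ne V) _ _ _

/-- **`hGR₀` is free**: the compatible splitting of the LINE pair of slot `0`. -/
theorem compat_line₀ :
    (cmSplittingDatum (L : Type) e₁ (frameD V) (frameD_real V) (frameD_ne V) (lineVec (L : Type) (dW (cDiag Φ σ a ha ha0).D 0))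
      (fun _ => dW_real (cDiag Φ σ a ha ha0).D 0) (fun _ => dW_ne (cDiag Φ σ a ha ha0).D 0)).CompatibleSplitting :=
  compatibleSplitting_cmSplittingDatum (L : Type) e₁ (frameD V) (frameD_real V) (frameD_ne V) _ _ _

/-- `hGR₁` is free. -/
theorem compat_line₁ :
    (cmSplittingDatum (L : Type) e₁ (frameD V) (frameD_real V) (frameD_ne V) (lineVec (L : Type) (dW (cDiag Φ σ a ha ha0).D 1))
      (fun _ => dW_real (cDiag Φ σ a ha ha0).D 1) (fun _ => dW_ne (cDiag Φ σ a ha ha0).D 1)).CompatibleSplitting :=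
  compatibleSplitting_cmSplittingDatum (L : Type) e₁ (frameD V) (frameD_real V) (frameD_ne V) _ _ _

/-- `hGR₂` is free. -/
theorem compat_line₂ :
    (cmSplittingDatum (L : Type) e₁ (frameD V) (frameD_real V) (frameD_ne V) (lineVec (L : Type) (dW' (cDiag Φ σ a ha ha0).D 0))
      (fun _ => dW'_real (cDiag Φ σ a ha ha0).D 0) (fun _ => dW'_ne (cDiag Φ σ a ha ha0).D 0)).CompatibleSplitting :=
  compatibleSplitting_cmSplittingDatum (L : Type) e₁ (frameD V) (frameD_real V) (frameD_ne V) _ _ _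

/-- `hGR₃` is free. -/
theorem compat_line₃ :
    (cmSplittingDatum (L : Type) e₁ (frameD V) (frameD_real V) (frameD_ne V) (lineVec (L : Type) (dW' (cDiag Φ σ a ha ha0).D 1))
      (fun _ => dW'_real (cDiag Φ σ a ha ha0).D 1) (fun _ => dW'_ne (cDiag Φ σ a ha ha0).D 1)).CompatibleSplitting :=
  compatibleSplitting_cmSplittingDatum (L : Type) e₁ (frameD V) (frameD_real V) (frameD_ne V) _ _ _

omit V in
/-- **`h₁W` is free**: a real non-zero `a` has `re ι₁(a) ≠ 0`, so the (equal) lines of `cDiag a` are all positive or all negative at `ι₁`. -/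
theorem h₁W_cDiag :
    (∀ j, 0 < (ι₁ (dW (cDiag Φ σ a ha ha0).D j)).re) ∨ ∀ j, (ι₁ (dW (cDiag Φ σ a ha ha0).D j)).re < 0 := by
  have hre : (ι₁ a).re ≠ 0 := by
    intro h
    have him : (ι₁ a).im = 0 := by
      have h2 := IsCMField.complexEmbedding_complexConj (L : Type) ι₁ a
      rw [ha] at h2
      have h3 := congrArg Complex.im h2
      simp only [Complex.conj_im] at h3
      linarith
    exact ha0 ((map_eq_zero ι₁).1 (Complex.ext h him))
  rcases lt_or_gt_of_ne hre with hlt | hgt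
  · exact Or.inr fun j => by rw [dW_cDiag]; exact hlt
  · exact Or.inl fun j => by rw [dW_cDiag]; exact hgt

end ReadBack

/-! ## §2 The side at the diagonal context: the model's ν-carrying (R1) term `archSideOfT` -/

section Side

variable (Φ : CMType (L : Type)) (σ : (L : Type) →+* ℂ) (a : (L : Type)) (ha : IsCMField.complexConj (L : Type) a = a) (ha0 : a ≠ 0)
variable (η : CMAdelic (L : Type) (frameD V) × CMAdelic (L : Type) (dW (cDiag Φ σ a ha ha0).D) →* ℂˣ)
  (hη : ∀ γU ∈ CMRat (L : Type) (frameD V), ∀ γ ∈ CMRat (L : Type) (dW (cDiag Φ σ a ha ha0).D), η (γU, γ) = 1)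
  (hηc : Continuous fun p => ((η p : ℂˣ) : ℂ))
  (ν : CMAdelic (L : Type) (frameD V) →* ℂˣ)
  (hν : ∀ γU ∈ CMRat (L : Type) (frameD V), ν γU = 1)
  (hνc : Continuous fun v => ((ν v : ℂˣ) : ℂ))
  (A : ∀ k : Fin 4, ArchLineInput V (lineRepT V (cDiag Φ σ a ha ha0).D (compat_plane V Φ σ a ha ha0) (compat_line₀ V Φ σ a ha ha0)
    (compat_line₁ V Φ σ a ha ha0) (compat_line₂ V Φ σ a ha ha0) (compat_line₃ V Φ σ a ha ha0) η ν k))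

/-- **THE SIDE AT THE LINE `a`**: the model's (R1) pin term `archSideOfT` at the diagonal context, compatible splittings and the sign clause
DISCHARGED (§1); inputs: the pair character `η` (automorphic, continuous), the `U(V)`-twist `ν` (automorphic, continuous), the archimedean test data `A`. -/
def sideAt : ThetaAdelicSide V (cDiag Φ σ a ha ha0) :=
  archSideOfT V (cDiag Φ σ a ha ha0) (compat_plane V Φ σ a ha ha0) (compat_line₀ V Φ σ a ha ha0) (compat_line₁ V Φ σ a ha ha0)
    (compat_line₂ V Φ σ a ha ha0) (compat_line₃ V Φ σ a ha ha0) η hη hηc ν hν hνc (h₁W_cDiag Φ σ a ha ha0) A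

/-- read-back: the slot-`k` Weil representation of the side is `lineRepOf … (etaT₀ η ν) (etaT₁ η ν) (eta₂ η) (eta₃ η) k`. -/
theorem sideAt_P_ω (k : Fin 4) :
    ((sideAt V Φ σ a ha ha0 η hη hηc ν hν hνc A).P k).ω =
      lineRepOf V (cDiag Φ σ a ha ha0).D (compat_plane V Φ σ a ha ha0) (compat_line₀ V Φ σ a ha ha0) (compat_line₁ V Φ σ a ha ha0)
        (compat_line₂ V Φ σ a ha ha0) (compat_line₃ V Φ σ a ha ha0) (etaT₀ V (cDiag Φ σ a ha ha0).D η ν)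
        (etaT₁ V (cDiag Φ σ a ha ha0).D η ν) (eta₂ V (cDiag Φ σ a ha ha0).D η) (eta₃ V (cDiag Φ σ a ha ha0).D η) k :=
  rfl

/-- read-back: the archimedean component of the side is the model's `archInfOf V`. -/
theorem sideAt_ιinf : (sideAt V Φ σ a ha ha0 η hη hηc ν hν hνc A).ιinf = archInfOf V := rfl

/-- read-back: the rational subgroup of every slot is the regime model's `Γ`. -/
theorem sideAt_P_ΓU (k : Fin 4) :
    ((sideAt V Φ σ a ha ha0 η hη hηc ν hν hνc A).P k).ΓU = (V.latticeModel printFact_unitaryCompact_holds).Γ := rfl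

/-! ## §3 The honest product datum of slot `0` at the line `a` -/

variable (hV : IsAnisotropic L V.Hm)

/-- **THE THETA-DISTRIBUTION DATUM AT THE LINE `a`** (slot `0` of the diagonal context): the model's (J4) datum `thetaDistDatumZeroOfT` over `sideAt`;
inputs: the harmonic archimedean family `Φarch` with its law `harm` at `lineOmega_zero … (etaT₀ η ν)` and the definite-place clause `hdef`. -/
def distDatumAt (Φarch : Module.Dual ℂ (Fin 2 → ℂ) →ₗ[ℂ] 𝓢((Fin 3 → mixedSpace (↥(maximalRealSubfield L))), ℂ))
    (harm : ∀ (u : ↥(stabilizer U21 x₀)) (ℓ : Module.Dual ℂ (Fin 2 → ℂ)),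
      lineOmega_zero V (cDiag Φ σ a ha ha0).D (compat_plane V Φ σ a ha ha0) (compat_line₀ V Φ σ a ha ha0) (compat_line₁ V Φ σ a ha ha0)
          (etaT₀ V (cDiag Φ σ a ha ha0).D η ν) (u : U21) (Φarch ℓ) =
        Φarch ((BallForms.isPullbackCocycle_cotangentCocycle.weightOf x₀).dual u ℓ))
    (hdef : ∀ g : UnitaryGroup.arch (↥(maximalRealSubfield L)) L (IsCMField.complexConj L) 3 V.Hm,
      UnitaryGroup.archAt (↥(maximalRealSubfield L)) L (IsCMField.complexConj L) 3 V.Hm (UnitaryGroup.cmPlace (L : Type) ι₁)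
          (NumberField.complexConj_smul_infinitePlace (L : Type) _) (IsCMField.complexConj_ne_one (L : Type)) g = 1 →
      ∀ (ℓ : Module.Dual ℂ (Fin 2 → ℂ)) (Φf : FinSB (↥(maximalRealSubfield L)) (Fin 3)),
        lineRepOf V (cDiag Φ σ a ha ha0).D (compat_plane V Φ σ a ha ha0) (compat_line₀ V Φ σ a ha ha0) (compat_line₁ V Φ σ a ha ha0)
            (compat_line₂ V Φ σ a ha ha0) (compat_line₃ V Φ σ a ha ha0) (etaT₀ V (cDiag Φ σ a ha ha0).D η ν)
            (etaT₁ V (cDiag Φ σ a ha ha0).D η ν) (eta₂ V (cDiag Φ σ a ha ha0).D η) (eta₃ V (cDiag Φ σ a ha ha0).D η) 0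
            (HodgeCM.Adelic.regimeEquiv L V.Hm hV
              (UnitaryGroup.archToAdelic (↥(maximalRealSubfield L)) L (IsCMField.complexConj L) 3 V.Hm g), 1)
            (piSchwartzBruhatEquiv (↥(maximalRealSubfield L)) (Fin 3) (Φarch ℓ ⊗ₜ[ℂ] Φf)) =
          piSchwartzBruhatEquiv (↥(maximalRealSubfield L)) (Fin 3) (Φarch ℓ ⊗ₜ[ℂ] Φf)) :
    (sideAt V Φ σ a ha ha0 η hη hηc ν hν hνc A).ThetaDistDatum hV 0 :=
  thetaDistDatumZeroOfT V (cDiag Φ σ a ha ha0) (compat_plane V Φ σ a ha ha0) (compat_line₀ V Φ σ a ha ha0) (compat_line₁ V Φ σ a ha ha0)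
    (compat_line₂ V Φ σ a ha ha0) (compat_line₃ V Φ σ a ha ha0) (h₁W_cDiag Φ σ a ha ha0) hV η hη hηc ν hν hνc A Φarch harm hdef

section DatumReadBack

variable (Φarch : Module.Dual ℂ (Fin 2 → ℂ) →ₗ[ℂ] 𝓢((Fin 3 → mixedSpace (↥(maximalRealSubfield L))), ℂ))
  (harm : ∀ (u : ↥(stabilizer U21 x₀)) (ℓ : Module.Dual ℂ (Fin 2 → ℂ)),
    lineOmega_zero V (cDiag Φ σ a ha ha0).D (compat_plane V Φ σ a ha ha0) (compat_line₀ V Φ σ a ha ha0) (compat_line₁ V Φ σ a ha ha0)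
        (etaT₀ V (cDiag Φ σ a ha ha0).D η ν) (u : U21) (Φarch ℓ) =
      Φarch ((BallForms.isPullbackCocycle_cotangentCocycle.weightOf x₀).dual u ℓ))
  (hdef : ∀ g : UnitaryGroup.arch (↥(maximalRealSubfield L)) L (IsCMField.complexConj L) 3 V.Hm,
    UnitaryGroup.archAt (↥(maximalRealSubfield L)) L (IsCMField.complexConj L) 3 V.Hm (UnitaryGroup.cmPlace (L : Type) ι₁)
        (NumberField.complexConj_smul_infinitePlace (L : Type) _) (IsCMField.complexConj_ne_one (L : Type)) g = 1 →
    ∀ (ℓ : Module.Dual ℂ (Fin 2 → ℂ)) (Φf : FinSB (↥(maximalRealSubfield L)) (Fin 3)),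
      lineRepOf V (cDiag Φ σ a ha ha0).D (compat_plane V Φ σ a ha ha0) (compat_line₀ V Φ σ a ha ha0) (compat_line₁ V Φ σ a ha ha0)
          (compat_line₂ V Φ σ a ha ha0) (compat_line₃ V Φ σ a ha ha0) (etaT₀ V (cDiag Φ σ a ha ha0).D η ν)
          (etaT₁ V (cDiag Φ σ a ha ha0).D η ν) (eta₂ V (cDiag Φ σ a ha ha0).D η) (eta₃ V (cDiag Φ σ a ha ha0).D η) 0
          (HodgeCM.Adelic.regimeEquiv L V.Hm hV
            (UnitaryGroup.archToAdelic (↥(maximalRealSubfield L)) L (IsCMField.complexConj L) 3 V.Hm g), 1)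
          (piSchwartzBruhatEquiv (↥(maximalRealSubfield L)) (Fin 3) (Φarch ℓ ⊗ₜ[ℂ] Φf)) =
        piSchwartzBruhatEquiv (↥(maximalRealSubfield L)) (Fin 3) (Φarch ℓ ⊗ₜ[ℂ] Φf))

/-- read-back: **the finite Weil representation of the datum at the line `a`** is the model's `finRepZero` at the diagonal context with the
character `etaT₀ η ν` — the model-side term of JUNCTION J (to be matched with the pin's `finPairRepW … (JW a) … (hs a)`). -/
theorem distDatumAt_ωf :
    (distDatumAt V Φ σ a ha ha0 η hη hηc ν hν hνc A hV Φarch harm hdef).ωf =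
      finRepZero V (cDiag Φ σ a ha ha0).D (compat_plane V Φ σ a ha ha0) (compat_line₀ V Φ σ a ha ha0) (compat_line₁ V Φ σ a ha ha0)
        (etaT₀ V (cDiag Φ σ a ha ha0).D η ν) :=
  rfl

/-- read-back: the finite `U(W₀)(𝔸_f)` of the datum is the model's `UfZero` of the diagonal context (the line `⟨a⟩` in the spelling
`Matrix.diagonal (lineVec a)`). -/
theorem distDatumAt_Uf : (distDatumAt V Φ σ a ha ha0 η hη hηc ν hν hνc A hV Φarch harm hdef).Uf = UfZero (cDiag Φ σ a ha ha0).D := rfl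

/-- read-back: the archimedean Weil representation of the datum at `ι₁` is the model's `lineOmega_zero` with the character `etaT₀ η ν`. -/
theorem distDatumAt_ωA :
    (distDatumAt V Φ σ a ha ha0 η hη hηc ν hν hνc A hV Φarch harm hdef).ωA =
      lineOmega_zero V (cDiag Φ σ a ha ha0).D (compat_plane V Φ σ a ha ha0) (compat_line₀ V Φ σ a ha ha0) (compat_line₁ V Φ σ a ha ha0)
        (etaT₀ V (cDiag Φ σ a ha ha0).D η ν) :=
  rfl

/-- read-back: the harmonic archimedean family of the datum is the input `Φarch`. -/
theorem distDatumAt_Φarch : (distDatumAt V Φ σ a ha ha0 η hη hηc ν hν hνc A hV Φarch harm hdef).Φarch = Φarch := rfl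

/-- read-back: the torus identification of the datum is the model's `finLineTorusIdeles` at the line `a`. -/
theorem distDatumAt_toIdele :
    (distDatumAt V Φ σ a ha ha0 η hη hηc ν hν hνc A hV Φarch harm hdef).toIdele =
      finLineTorusIdeles (L : Type) (dW (cDiag Φ σ a ha ha0).D 0) (dW_ne (cDiag Φ σ a ha ha0).D 0) :=
  rfl

end DatumReadBack

end Side

end Summit.HodgeConjecture.HodgeConjecture.Cruxes.H413.ThetaDistAtLine

end
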